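import Mathlib
import Literature.Probability.LatticeModels.GKSInequalities
import Summits.CriticalPhenomena.Ising3DConformalLimit.Theorems.PrecisionLaplacianInverseMFerromagnetImNonadjOfLaw2Aux
import HarnessLib

/-!
# Crux `PrecisionLaplacian.MoebiusLimitOfTwoPointLaw` (stmt-CriticalPhenomena-4801), line `Sketch` —
# auxiliary lemmas for stub `stub_amputatedLebowitz_triangle_of_inverseM` (the ghost construction)

THEOREM-ONLY helper file (no definitions).  Zero-field pair spin systems `gksExpect univ K C` on
`Fin n` (`|C i| = 2`), a distinct triple `X = {x₂, x₃, x₄}` and `ε > 0`.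

* The constants of the ghost construction (`ghost_kappa_eq`, `ghost_kappa_neg`, `ghost_t_nonneg`,
  `ghost_t_le`, `ghost_walsh`): on `{±1}³`,
  `tanh (ε(s₂+s₃+s₄)) = α (s₂+s₃+s₄) + κ s₂s₃s₄` with `κ = (tanh 3ε − 3 tanh ε)/4 = −2 sinh³ε / cosh 3ε < 0`,
  `cosh (ε(s₂+s₃+s₄)) = e^c · exp (t (s₃s₄ + s₂s₄ + s₂s₃))` with `t = (log cosh 3ε − log cosh ε)/4 ∈ [0, ε]`.
* One-point Schur complements (`ghost_sum_split`, `ghost_schur_row`, `ghost_schur_pos`): for a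
  positive definite `N`, a point `z` and `S = univ ∖ {z}` enumerated by an injection `g`,
  `v_z − N_{zS}(N_SS)⁻¹v_S = (N_zz − N_{zS}(N_SS)⁻¹N_{Sz}) · (N⁻¹v)_z` for every vector `v`, and the
  Schur factor is `> 0`.
* The ghost extension (`ghost_sum_snoc`, `ghost_ham_target`, `ghost_ham_ext`, `ghost_gksSum_ext`,
  `ghost_gksSum_ext_odd`, `ghost_gksExpect_ext`, `ghost_gksExpect_ext_odd`): add a ghost site
  `g = Fin.last n` to `Fin n` (old sites embedded by `Fin.castSucc`), coupled `ε` to `x₂, x₃, x₄`.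
  Summing out `σ_g` (`SpinConfig (Fin (n+1)) ≃ SpinConfig (Fin n) × ℤˣ` along `Fin.snocEquiv`):
  for observables `F` of the old spins, `⟨F⟩_ext = ⟨F⟩_t` and `⟨σ_g F⟩_ext = ⟨tanh(ε(σ₂+σ₃+σ₄)) F⟩_t`,
  where `t` indexes the TARGET system on `Fin n` with the three extra bonds `{x₃,x₄}, {x₂,x₄}, {x₂,x₃}`
  of coupling `t` (bond type `Fin (m + 3)`, `Fin.append`).
-/

namespace Summit.CriticalPhenomena.Ising3DConformalLimit.PrecisionLaplacianMoebiusLimitOfTwoPointLaw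

open Literature.Probability.LatticeModels Finset Matrix
open Summit.CriticalPhenomena.Ising3DConformalLimit.Cruxes.InverseMFerromagnet.PartialCovarianceLadder
  (c2_spinProduct_pair)

/-! ## The constants of the ghost construction -/

/-- `(tanh 3ε − 3 tanh ε)/4 = −2 sinh³ ε / cosh 3ε`. [folklore] -/
theorem ghost_kappa_eq (ε : ℝ) :
    (Real.tanh (3 * ε) - 3 * Real.tanh ε) / 4 = -(2 * Real.sinh ε ^ 3 / Real.cosh (3 * ε)) := by
  have hc : Real.cosh ε ≠ 0 := (Real.cosh_pos ε).ne'
  have hc3 : Real.cosh (3 * ε) ≠ 0 := (Real.cosh_pos _).ne'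
  rw [Real.tanh_eq_sinh_div_cosh, Real.tanh_eq_sinh_div_cosh]
  field_simp
  rw [Real.sinh_three_mul, Real.cosh_three_mul]
  linear_combination (-12 * Real.sinh ε * Real.cosh ε) * Real.cosh_sq ε

/-- The cubic Walsh coefficient `κ = (tanh 3ε − 3 tanh ε)/4` of `tanh (ε(s₂+s₃+s₄))` is `< 0` for
`ε > 0`. [folklore] -/
theorem ghost_kappa_neg {ε : ℝ} (hε : 0 < ε) :
    (Real.tanh (3 * ε) - 3 * Real.tanh ε) / 4 < 0 := by
  rw [ghost_kappa_eq, neg_lt_zero]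
  exact div_pos (mul_pos two_pos (pow_pos (Real.sinh_pos_iff.2 hε) 3)) (Real.cosh_pos _)

/-- `t = (log cosh 3ε − log cosh ε)/4 ≥ 0`. [folklore] -/
theorem ghost_t_nonneg (ε : ℝ) :
    0 ≤ (Real.log (Real.cosh (3 * ε)) - Real.log (Real.cosh ε)) / 4 := by
  have h : Real.cosh ε ≤ Real.cosh (3 * ε) := by
    rw [Real.cosh_le_cosh, abs_mul, abs_of_pos (by norm_num : (0:ℝ) < 3)]
    linarith [abs_nonneg ε]
  linarith [Real.log_le_log (Real.cosh_pos ε) h]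

/-- `t = (log cosh 3ε − log cosh ε)/4 ≤ ε` for `ε ≥ 0` (`cosh 3ε ≤ e^{2ε} cosh ε`). [folklore] -/
theorem ghost_t_le {ε : ℝ} (hε : 0 ≤ ε) :
    (Real.log (Real.cosh (3 * ε)) - Real.log (Real.cosh ε)) / 4 ≤ ε := by
  have h1 : Real.cosh (3 * ε) ≤ Real.exp (2 * ε) * Real.cosh ε := by
    rw [show 3 * ε = 2 * ε + ε by ring, Real.cosh_add, ← Real.cosh_add_sinh (2 * ε)]
    nlinarith [Real.sinh_lt_cosh ε, Real.sinh_nonneg_iff.2 (by linarith : 0 ≤ 2 * ε),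
      Real.cosh_pos ε]
  have h2 := Real.log_le_log (Real.cosh_pos _) h1
  rw [Real.log_mul (Real.exp_pos _).ne' (Real.cosh_pos _).ne', Real.log_exp] at h2
  linarith

/-- **Three equal couplings on `{±1}³`.** Walsh form of `tanh (ε(a+b+d))` with the explicit
coefficients `α = (tanh 3ε + tanh ε)/4`, `κ = (tanh 3ε − 3 tanh ε)/4`, and star–triangle form of
`cosh (ε(a+b+d)) = e^c exp (t (bd + ad + ab))`, `c = (log cosh 3ε + 3 log cosh ε)/4`,
`t = (log cosh 3ε − log cosh ε)/4`. [folklore] -/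
theorem ghost_walsh (ε a b d : ℝ) (ha : a = 1 ∨ a = -1) (hb : b = 1 ∨ b = -1)
    (hd : d = 1 ∨ d = -1) :
    Real.tanh (ε * (a + b + d))
        = (Real.tanh (3 * ε) + Real.tanh ε) / 4 * (a + b + d)
          + (Real.tanh (3 * ε) - 3 * Real.tanh ε) / 4 * (a * b * d) ∧
      Real.cosh (ε * (a + b + d))
        = Real.exp ((Real.log (Real.cosh (3 * ε)) + 3 * Real.log (Real.cosh ε)) / 4)
          * Real.exp ((Real.log (Real.cosh (3 * ε)) - Real.log (Real.cosh ε)) / 4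
            * (b * d + a * d + a * b)) := by
  have n1 : Real.tanh (-(3 * ε)) = -Real.tanh (3 * ε) := Real.tanh_neg _
  have n2 : Real.tanh (-ε) = -Real.tanh ε := Real.tanh_neg _
  have m1 : Real.cosh (-(3 * ε)) = Real.cosh (3 * ε) := Real.cosh_neg _
  have m2 : Real.cosh (-ε) = Real.cosh ε := Real.cosh_neg _
  rw [← Real.exp_add]
  rcases ha with rfl | rfl <;> rcases hb with rfl | rfl <;> rcases hd with rfl | rfl
  · rw [show ε * (1 + 1 + 1) = 3 * ε by ring]
    exact ⟨by ring, (Real.exp_log (Real.cosh_pos _)).symm.trans (by congr 1; ring)⟩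
  · rw [show ε * (1 + 1 + -1) = ε by ring]
    exact ⟨by ring, (Real.exp_log (Real.cosh_pos _)).symm.trans (by congr 1; ring)⟩
  · rw [show ε * (1 + -1 + 1) = ε by ring]
    exact ⟨by ring, (Real.exp_log (Real.cosh_pos _)).symm.trans (by congr 1; ring)⟩
  · rw [show ε * (1 + -1 + -1) = -ε by ring, n2, m2]
    exact ⟨by ring, (Real.exp_log (Real.cosh_pos _)).symm.trans (by congr 1; ring)⟩
  · rw [show ε * (-1 + 1 + 1) = ε by ring]
    exact ⟨by ring, (Real.exp_log (Real.cosh_pos _)).symm.trans (by congr 1; ring)⟩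
  · rw [show ε * (-1 + 1 + -1) = -ε by ring, n2, m2]
    exact ⟨by ring, (Real.exp_log (Real.cosh_pos _)).symm.trans (by congr 1; ring)⟩
  · rw [show ε * (-1 + -1 + 1) = -ε by ring, n2, m2]
    exact ⟨by ring, (Real.exp_log (Real.cosh_pos _)).symm.trans (by congr 1; ring)⟩
  · rw [show ε * (-1 + -1 + -1) = -(3 * ε) by ring, n1, m1]
    exact ⟨by ring, (Real.exp_log (Real.cosh_pos _)).symm.trans (by congr 1; ring)⟩

/-! ## One-point Schur complements (pure linear algebra on a positive definite matrix) -/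

/-- Splitting a sum over a finite type `ι` into the point `z` and the rest, the rest being
enumerated by an injection `g : κ → ι` onto `ι ∖ {z}`. [folklore] -/
theorem ghost_sum_split {ι κ : Type*} [Fintype ι] [Fintype κ] (z : ι)
    (g : κ → ι) (hg : Function.Injective g) (hgz : ∀ k, g k ≠ z)
    (hsurj : ∀ a, a ≠ z → ∃ k, g k = a) (f : ι → ℝ) :
    ∑ k, f k = f z + ∑ k : κ, f (g k) := by
  classical
  have himage : (Finset.univ : Finset κ).image g = Finset.univ.erase z := by
    ext a
    simp only [Finset.mem_image, Finset.mem_univ, true_and, Finset.mem_erase, and_true]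
    constructor
    · rintro ⟨k, rfl⟩
      exact hgz k
    · exact hsurj a
  have h2 : ∑ k : κ, f (g k) = ∑ a ∈ Finset.univ.erase z, f a := by
    rw [← himage, Finset.sum_image fun a _ b _ h => hg h]
  rw [h2, Finset.add_sum_erase _ _ (Finset.mem_univ z)]

/-- **Row `z` of the inverse.** For a positive definite real matrix `N` on a finite type `ι`, a
point `z` and the complement `ι ∖ {z}` enumerated by an injection `g : κ → ι`, and any vector
`v`: `v_z − N_{zS}(N_SS)⁻¹v_S = (N_zz − N_{zS}(N_SS)⁻¹N_{Sz}) · (N⁻¹v)_z`. [folklore] -/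
theorem ghost_schur_row {ι κ : Type*} [Fintype ι] [DecidableEq ι] [Fintype κ] [DecidableEq κ]
    (N : Matrix ι ι ℝ) (hN : N.PosDef) (z : ι) (g : κ → ι) (hg : Function.Injective g)
    (hgz : ∀ k, g k ≠ z) (hsurj : ∀ a, a ≠ z → ∃ k, g k = a) (v : ι → ℝ) :
    v z - ∑ p, ∑ q, N z (g p) * (N.submatrix g g)⁻¹ p q * v (g q)
      = (N z z - ∑ p, ∑ q, N z (g p) * (N.submatrix g g)⁻¹ p q * N (g q) z)
        * (N⁻¹.mulVec v) z := by
  set D : Matrix κ κ ℝ := N.submatrix g g with hD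
  set w : ι → ℝ := N⁻¹.mulVec v with hw
  have hDpd : D.PosDef := hN.submatrix hg
  have hNN : N * N⁻¹ = 1 :=
    Matrix.mul_nonsing_inv N ((Matrix.isUnit_iff_isUnit_det N).mp hN.isUnit)
  have hDD : D⁻¹ * D = 1 :=
    Matrix.nonsing_inv_mul D ((Matrix.isUnit_iff_isUnit_det D).mp hDpd.isUnit)
  have hNw : N.mulVec w = v := by
    rw [hw, Matrix.mulVec_mulVec, hNN, Matrix.one_mulVec]
  -- the equations `v_a = N_{az} w_z + ∑_k N_{a,g k} w_{g k}`
  have hE : ∀ a, v a = N a z * w z + ∑ k, N a (g k) * w (g k) := by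
    intro a
    rw [← hNw]
    simp only [Matrix.mulVec, dotProduct]
    rw [ghost_sum_split z g hg hgz hsurj]
  -- the `κ`-part of `w`, eliminated with `D⁻¹`
  have hy : ∀ k, w (g k) = ∑ q, D⁻¹ k q * (v (g q) - N (g q) z * w z) := by
    have h1 : D.mulVec (fun k => w (g k)) = fun p => v (g p) - N (g p) z * w z := by
      funext p
      rw [hE (g p)]
      simp only [Matrix.mulVec, dotProduct, hD, Matrix.submatrix_apply]
      ring
    have h2 : (fun k => w (g k)) = D⁻¹.mulVec (fun p => v (g p) - N (g p) z * w z) := by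
      rw [← h1, Matrix.mulVec_mulVec, hDD, Matrix.one_mulVec]
    intro k
    have h3 := congrFun h2 k
    simp only [Matrix.mulVec, dotProduct] at h3
    exact h3
  have hz := hE z
  simp only [hy, Finset.mul_sum] at hz
  rw [hz]
  have e1 : ∑ x, ∑ i, N z (g x) * (D⁻¹ x i * (v (g i) - N (g i) z * w z))
      = ∑ p, ∑ q, N z (g p) * D⁻¹ p q * v (g q)
        - (∑ p, ∑ q, N z (g p) * D⁻¹ p q * N (g q) z) * w z := by
    rw [Finset.sum_mul, ← Finset.sum_sub_distrib]
    refine Finset.sum_congr rfl fun p _ => ?_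
    rw [Finset.sum_mul, ← Finset.sum_sub_distrib]
    exact Finset.sum_congr rfl fun q _ => by ring
  rw [e1]
  ring

/-- The one-point Schur complement `N_zz − N_{zS}(N_SS)⁻¹N_{Sz}` of a positive definite matrix is
positive (it is `1 / (N⁻¹)_zz`). [folklore] -/
theorem ghost_schur_pos {ι κ : Type*} [Fintype ι] [DecidableEq ι] [Fintype κ] [DecidableEq κ]
    (N : Matrix ι ι ℝ) (hN : N.PosDef) (z : ι) (g : κ → ι) (hg : Function.Injective g)
    (hgz : ∀ k, g k ≠ z) (hsurj : ∀ a, a ≠ z → ∃ k, g k = a) :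
    0 < N z z - ∑ p, ∑ q, N z (g p) * (N.submatrix g g)⁻¹ p q * N (g q) z := by
  have h := ghost_schur_row N hN z g hg hgz hsurj (Pi.single z 1)
  have h0 : ∀ k, (Pi.single z (1 : ℝ) : ι → ℝ) (g k) = 0 := fun k => Pi.single_eq_of_ne (hgz k) _
  simp only [h0, mul_zero, Finset.sum_const_zero, sub_zero, Pi.single_eq_same] at h
  have hdiag : 0 < N⁻¹ z z := hN.inv.diag_pos
  have h2 : (N⁻¹.mulVec (Pi.single z 1)) z = N⁻¹ z z := by
    rw [Matrix.mulVec_single_one, Matrix.col_apply]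
  rw [h2] at h
  exact pos_of_mul_pos_left (h ▸ one_pos) hdiag.le

/-! ## The ghost extension and its marginal on the old spins -/

/-- Sum over configurations on `Fin (n+1)` = sum over (configuration on `Fin n`, last spin `±1`),
along `Fin.snocEquiv`. [folklore] -/
theorem ghost_sum_snoc {n : ℕ} (Φ : SpinConfig (Fin (n + 1)) → ℝ) :
    ∑ ω, Φ ω = ∑ σ : SpinConfig (Fin n),
      (Φ (Fin.snoc σ 1 : SpinConfig (Fin (n + 1))) + Φ (Fin.snoc σ (-1) : SpinConfig (Fin (n + 1)))) := by
  rw [← Equiv.sum_comp (Fin.snocEquiv fun _ : Fin (n + 1) => ℤˣ) Φ, Fintype.sum_prod_type,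
    Finset.sum_comm]
  refine Finset.sum_congr rfl fun σ _ => ?_
  rw [UnitsInt.univ, Finset.sum_pair (by decide)]
  rfl

/-- The Hamiltonian of the target system: the old bonds plus the three extra bonds
`{x₃,x₄}, {x₂,x₄}, {x₂,x₃}` of coupling `t`. [folklore] -/
theorem ghost_ham_target {n m : ℕ} (K : Fin m → ℝ) (C : Fin m → Finset (Fin n)) (t : ℝ)
    {x₂ x₃ x₄ : Fin n} (h23 : x₂ ≠ x₃) (h24 : x₂ ≠ x₄) (h34 : x₃ ≠ x₄) (σ : SpinConfig (Fin n)) :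
    gksHamiltonian Finset.univ (Fin.append K (fun _ : Fin 3 => t))
        (Fin.append C ![{x₃, x₄}, {x₂, x₄}, {x₂, x₃}]) σ
      = gksHamiltonian Finset.univ K C σ
        + t * (spinAt x₃ σ * spinAt x₄ σ + spinAt x₂ σ * spinAt x₄ σ + spinAt x₂ σ * spinAt x₃ σ) := by
  unfold gksHamiltonian
  rw [Fin.sum_univ_add]
  simp only [Fin.append_left, Fin.append_right, Fin.sum_univ_three, Matrix.cons_val_zero,
    Matrix.cons_val_one, Matrix.cons_val_two, Matrix.head_cons, Matrix.tail_cons,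
    c2_spinProduct_pair h34, c2_spinProduct_pair h24, c2_spinProduct_pair h23]
  ring

/-- The Hamiltonian of the ghost extension: the old bonds on the old sites (embedded by
`Fin.castSucc`), plus the ghost `g = Fin.last n` coupled `ε` to `x₂, x₃, x₄`. [folklore] -/
theorem ghost_ham_ext {n m : ℕ} (K : Fin m → ℝ) (C : Fin m → Finset (Fin n)) (ε : ℝ)
    (x₂ x₃ x₄ : Fin n) (ω : SpinConfig (Fin (n + 1))) :
    gksHamiltonian Finset.univ (Fin.append K (fun _ : Fin 3 => ε))
        (Fin.append (fun i => (C i).map Fin.castSuccEmb)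
          ![{Fin.last n, x₂.castSucc}, {Fin.last n, x₃.castSucc}, {Fin.last n, x₄.castSucc}]) ω
      = gksHamiltonian Finset.univ K C (fun i => ω i.castSucc)
        + spinAt (Fin.last n) ω * (ε * (spinAt x₂ (fun i => ω i.castSucc)
          + spinAt x₃ (fun i => ω i.castSucc) + spinAt x₄ (fun i => ω i.castSucc))) := by
  have hpair : ∀ x : Fin n, spinProduct {Fin.last n, x.castSucc} ω
      = spinAt (Fin.last n) ω * spinAt x (fun i => ω i.castSucc) := fun x => by
    rw [c2_spinProduct_pair (Fin.castSucc_ne_last x).symm]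
    rfl
  have hold : ∀ i, spinProduct ((C i).map Fin.castSuccEmb) ω
      = spinProduct (C i) (fun i => ω i.castSucc) := fun i => by
    rw [spinProduct, Finset.prod_map]
    rfl
  unfold gksHamiltonian
  rw [Fin.sum_univ_add]
  simp only [Fin.append_left, Fin.append_right, Fin.sum_univ_three, Matrix.cons_val_zero,
    Matrix.cons_val_one, Matrix.cons_val_two, Matrix.head_cons, Matrix.tail_cons, hpair, hold]
  ring

/-- **Summing out the ghost.** For an observable `F` of the old spins,
`Z_ext⟨F⟩_ext = 2e^c · Z_t⟨F⟩_t` (`cosh (ε(σ₂+σ₃+σ₄)) = e^c e^{t(σ₃σ₄+σ₂σ₄+σ₂σ₃)}`). [folklore] -/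
theorem ghost_gksSum_ext {n m : ℕ} (K : Fin m → ℝ) (C : Fin m → Finset (Fin n)) (ε t c : ℝ)
    {x₂ x₃ x₄ : Fin n} (h23 : x₂ ≠ x₃) (h24 : x₂ ≠ x₄) (h34 : x₃ ≠ x₄)
    (hcosh : ∀ σ : SpinConfig (Fin n), Real.cosh (ε * (spinAt x₂ σ + spinAt x₃ σ + spinAt x₄ σ))
      = Real.exp c * Real.exp (t * (spinAt x₃ σ * spinAt x₄ σ + spinAt x₂ σ * spinAt x₄ σ
          + spinAt x₂ σ * spinAt x₃ σ)))
    (F : SpinConfig (Fin n) → ℝ) :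
    gksSum Finset.univ (Fin.append K (fun _ : Fin 3 => ε))
        (Fin.append (fun i => (C i).map Fin.castSuccEmb)
          ![{Fin.last n, x₂.castSucc}, {Fin.last n, x₃.castSucc}, {Fin.last n, x₄.castSucc}])
        (fun ω => F (fun i => ω i.castSucc))
      = 2 * Real.exp c * gksSum Finset.univ (Fin.append K (fun _ : Fin 3 => t))
          (Fin.append C ![{x₃, x₄}, {x₂, x₄}, {x₂, x₃}]) F := by
  simp only [gksSum, gksWeight, ghost_ham_ext, ghost_ham_target K C t h23 h24 h34]
  rw [ghost_sum_snoc, Finset.mul_sum]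
  refine Finset.sum_congr rfl fun σ _ => ?_
  have h1 : (fun i => (Fin.snoc σ 1 : SpinConfig (Fin (n + 1))) i.castSucc) = σ :=
    funext fun i => Fin.snoc_castSucc _ _ i
  have h2 : (fun i => (Fin.snoc σ (-1) : SpinConfig (Fin (n + 1))) i.castSucc) = σ :=
    funext fun i => Fin.snoc_castSucc _ _ i
  have h3 : spinAt (Fin.last n) (Fin.snoc σ 1 : SpinConfig (Fin (n + 1))) = 1 := by
    simp [spinAt, Fin.snoc_last]
  have h4 : spinAt (Fin.last n) (Fin.snoc σ (-1) : SpinConfig (Fin (n + 1))) = -1 := by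
    simp [spinAt, Fin.snoc_last]
  rw [h1, h2, h3, h4]
  have hc : Real.exp (ε * (spinAt x₂ σ + spinAt x₃ σ + spinAt x₄ σ))
      + Real.exp (-(ε * (spinAt x₂ σ + spinAt x₃ σ + spinAt x₄ σ)))
      = 2 * (Real.exp c * Real.exp (t * (spinAt x₃ σ * spinAt x₄ σ + spinAt x₂ σ * spinAt x₄ σ
          + spinAt x₂ σ * spinAt x₃ σ))) := by
    rw [← hcosh σ, Real.cosh_eq]
    ring
  simp only [Real.exp_add, one_mul, neg_one_mul]
  linear_combination (F σ * Real.exp (gksHamiltonian Finset.univ K C σ)) * hc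


/-- **Summing out the ghost against `σ_g`.**
`Z_ext⟨σ_g F⟩_ext = 2e^c · Z_t⟨tanh(ε(σ₂+σ₃+σ₄)) F⟩_t` (`2 sinh = 2 tanh · cosh`). [folklore] -/
theorem ghost_gksSum_ext_odd {n m : ℕ} (K : Fin m → ℝ) (C : Fin m → Finset (Fin n)) (ε t c : ℝ)
    {x₂ x₃ x₄ : Fin n} (h23 : x₂ ≠ x₃) (h24 : x₂ ≠ x₄) (h34 : x₃ ≠ x₄)
    (hcosh : ∀ σ : SpinConfig (Fin n), Real.cosh (ε * (spinAt x₂ σ + spinAt x₃ σ + spinAt x₄ σ))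
      = Real.exp c * Real.exp (t * (spinAt x₃ σ * spinAt x₄ σ + spinAt x₂ σ * spinAt x₄ σ
          + spinAt x₂ σ * spinAt x₃ σ)))
    (F : SpinConfig (Fin n) → ℝ) :
    gksSum Finset.univ (Fin.append K (fun _ : Fin 3 => ε))
        (Fin.append (fun i => (C i).map Fin.castSuccEmb)
          ![{Fin.last n, x₂.castSucc}, {Fin.last n, x₃.castSucc}, {Fin.last n, x₄.castSucc}])
        (fun ω => spinAt (Fin.last n) ω * F (fun i => ω i.castSucc))
      = 2 * Real.exp c * gksSum Finset.univ (Fin.append K (fun _ : Fin 3 => t))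
          (Fin.append C ![{x₃, x₄}, {x₂, x₄}, {x₂, x₃}])
          (fun σ => Real.tanh (ε * (spinAt x₂ σ + spinAt x₃ σ + spinAt x₄ σ)) * F σ) := by
  simp only [gksSum, gksWeight, ghost_ham_ext, ghost_ham_target K C t h23 h24 h34]
  rw [ghost_sum_snoc, Finset.mul_sum]
  refine Finset.sum_congr rfl fun σ _ => ?_
  have h1 : (fun i => (Fin.snoc σ 1 : SpinConfig (Fin (n + 1))) i.castSucc) = σ :=
    funext fun i => Fin.snoc_castSucc _ _ i
  have h2 : (fun i => (Fin.snoc σ (-1) : SpinConfig (Fin (n + 1))) i.castSucc) = σ :=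
    funext fun i => Fin.snoc_castSucc _ _ i
  have h3 : spinAt (Fin.last n) (Fin.snoc σ 1 : SpinConfig (Fin (n + 1))) = 1 := by
    simp [spinAt, Fin.snoc_last]
  have h4 : spinAt (Fin.last n) (Fin.snoc σ (-1) : SpinConfig (Fin (n + 1))) = -1 := by
    simp [spinAt, Fin.snoc_last]
  rw [h1, h2, h3, h4]
  have hs : Real.exp (ε * (spinAt x₂ σ + spinAt x₃ σ + spinAt x₄ σ))
      - Real.exp (-(ε * (spinAt x₂ σ + spinAt x₃ σ + spinAt x₄ σ)))
      = 2 * (Real.tanh (ε * (spinAt x₂ σ + spinAt x₃ σ + spinAt x₄ σ))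
        * (Real.exp c * Real.exp (t * (spinAt x₃ σ * spinAt x₄ σ + spinAt x₂ σ * spinAt x₄ σ
          + spinAt x₂ σ * spinAt x₃ σ)))) := by
    rw [← hcosh σ, Real.tanh_eq_sinh_div_cosh, div_mul_cancel₀ _ (Real.cosh_pos _).ne',
      Real.sinh_eq]
    ring
  simp only [Real.exp_add, one_mul, neg_one_mul]
  linear_combination (F σ * Real.exp (gksHamiltonian Finset.univ K C σ)) * hs

/-- **Marginal identity.** `⟨F⟩_ext = ⟨F⟩_t` for observables `F` of the old spins (the factor
`2e^c` cancels in the ratio). [folklore] -/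
theorem ghost_gksExpect_ext {n m : ℕ} (K : Fin m → ℝ) (C : Fin m → Finset (Fin n)) (ε t c : ℝ)
    {x₂ x₃ x₄ : Fin n} (h23 : x₂ ≠ x₃) (h24 : x₂ ≠ x₄) (h34 : x₃ ≠ x₄)
    (hcosh : ∀ σ : SpinConfig (Fin n), Real.cosh (ε * (spinAt x₂ σ + spinAt x₃ σ + spinAt x₄ σ))
      = Real.exp c * Real.exp (t * (spinAt x₃ σ * spinAt x₄ σ + spinAt x₂ σ * spinAt x₄ σ
          + spinAt x₂ σ * spinAt x₃ σ)))
    (F : SpinConfig (Fin n) → ℝ) :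
    gksExpect Finset.univ (Fin.append K (fun _ : Fin 3 => ε))
        (Fin.append (fun i => (C i).map Fin.castSuccEmb)
          ![{Fin.last n, x₂.castSucc}, {Fin.last n, x₃.castSucc}, {Fin.last n, x₄.castSucc}])
        (fun ω => F (fun i => ω i.castSucc))
      = gksExpect Finset.univ (Fin.append K (fun _ : Fin 3 => t))
          (Fin.append C ![{x₃, x₄}, {x₂, x₄}, {x₂, x₃}]) F := by
  have hA : (2 * Real.exp c) ≠ 0 := by positivity
  have h1 : gksSum Finset.univ (Fin.append K (fun _ : Fin 3 => ε))
      (Fin.append (fun i => (C i).map Fin.castSuccEmb)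
        ![{Fin.last n, x₂.castSucc}, {Fin.last n, x₃.castSucc}, {Fin.last n, x₄.castSucc}])
      (fun _ => (1 : ℝ))
      = 2 * Real.exp c * gksSum Finset.univ (Fin.append K (fun _ : Fin 3 => t))
          (Fin.append C ![{x₃, x₄}, {x₂, x₄}, {x₂, x₃}]) (fun _ => 1) :=
    ghost_gksSum_ext K C ε t c h23 h24 h34 hcosh (fun _ => (1 : ℝ))
  unfold gksExpect
  rw [ghost_gksSum_ext K C ε t c h23 h24 h34 hcosh F, h1]
  exact mul_div_mul_left _ _ hA

/-- **Callen identity through the marginal.** `⟨σ_g F⟩_ext = ⟨tanh(ε(σ₂+σ₃+σ₄)) F⟩_t` for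
observables `F` of the old spins. [folklore] -/
theorem ghost_gksExpect_ext_odd {n m : ℕ} (K : Fin m → ℝ) (C : Fin m → Finset (Fin n))
    (ε t c : ℝ) {x₂ x₃ x₄ : Fin n} (h23 : x₂ ≠ x₃) (h24 : x₂ ≠ x₄) (h34 : x₃ ≠ x₄)
    (hcosh : ∀ σ : SpinConfig (Fin n), Real.cosh (ε * (spinAt x₂ σ + spinAt x₃ σ + spinAt x₄ σ))
      = Real.exp c * Real.exp (t * (spinAt x₃ σ * spinAt x₄ σ + spinAt x₂ σ * spinAt x₄ σ
          + spinAt x₂ σ * spinAt x₃ σ)))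
    (F : SpinConfig (Fin n) → ℝ) :
    gksExpect Finset.univ (Fin.append K (fun _ : Fin 3 => ε))
        (Fin.append (fun i => (C i).map Fin.castSuccEmb)
          ![{Fin.last n, x₂.castSucc}, {Fin.last n, x₃.castSucc}, {Fin.last n, x₄.castSucc}])
        (fun ω => spinAt (Fin.last n) ω * F (fun i => ω i.castSucc))
      = gksExpect Finset.univ (Fin.append K (fun _ : Fin 3 => t))
          (Fin.append C ![{x₃, x₄}, {x₂, x₄}, {x₂, x₃}])
          (fun σ => Real.tanh (ε * (spinAt x₂ σ + spinAt x₃ σ + spinAt x₄ σ)) * F σ) := by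
  have hA : (2 * Real.exp c) ≠ 0 := by positivity
  have h1 : gksSum Finset.univ (Fin.append K (fun _ : Fin 3 => ε))
      (Fin.append (fun i => (C i).map Fin.castSuccEmb)
        ![{Fin.last n, x₂.castSucc}, {Fin.last n, x₃.castSucc}, {Fin.last n, x₄.castSucc}])
      (fun _ => (1 : ℝ))
      = 2 * Real.exp c * gksSum Finset.univ (Fin.append K (fun _ : Fin 3 => t))
          (Fin.append C ![{x₃, x₄}, {x₂, x₄}, {x₂, x₃}]) (fun _ => 1) :=
    ghost_gksSum_ext K C ε t c h23 h24 h34 hcosh (fun _ => (1 : ℝ))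
  unfold gksExpect
  rw [ghost_gksSum_ext_odd K C ε t c h23 h24 h34 hcosh F, h1]
  exact mul_div_mul_left _ _ hA

/-- Registered helper `helper_ghost_marginal` (representative of this auxiliary file): the marginal
of the ghost extension on the old spins is the target system with the `X`-triangle of coupling `t`
(`ghost_gksExpect_ext`). [folklore] -/
theorem helper_ghost_marginal : ∀ (n m : ℕ) (K : Fin m → ℝ) (C : Fin m → Finset (Fin n)) (ε t c : ℝ) (x₂ x₃ x₄ : Fin n), x₂ ≠ x₃ → x₂ ≠ x₄ → x₃ ≠ x₄ → (∀ σ : SpinConfig (Fin n), Real.cosh (ε * (spinAt x₂ σ + spinAt x₃ σ + spinAt x₄ σ)) = Real.exp c * Real.exp (t * (spinAt x₃ σ * spinAt x₄ σ + spinAt x₂ σ * spinAt x₄ σ + spinAt x₂ σ * spinAt x₃ σ))) → ∀ F : SpinConfig (Fin n) → ℝ, gksExpect Finset.univ (Fin.append K (fun _ : Fin 3 => ε)) (Fin.append (fun i => (C i).map Fin.castSuccEmb) ![{Fin.last n, x₂.castSucc}, {Fin.last n, x₃.castSucc}, {Fin.last n, x₄.castSucc}]) (fun ω => F (fun i =>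 ω i.castSucc)) = gksExpect Finset.univ (Fin.append K (fun _ : Fin 3 => t)) (Fin.append C ![{x₃, x₄}, {x₂, x₄}, {x₂, x₃}]) F :=
  fun _ _ K C ε t c _ _ _ h23 h24 h34 hcosh F => ghost_gksExpect_ext K C ε t c h23 h24 h34 hcosh F

end Summit.CriticalPhenomena.Ising3DConformalLimit.PrecisionLaplacianMoebiusLimitOfTwoPointLaw
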